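import Summits.AnomalousDissipation.AnomalousDissipation.Theorems.SolenoidalFractalHomogenisationLagrangianStepSidebandXEnergyDefs
import Summits.AnomalousDissipation.AnomalousDissipation.Theorems.SolenoidalFractalHomogenisationLagrangianStepSidebandXDefectD1
import Summits.AnomalousDissipation.AnomalousDissipation.Theorems.SolenoidalFractalHomogenisationLagrangianStepSidebandXApriori
import Summits.AnomalousDissipation.AnomalousDissipation.Theorems.SolenoidalFractalHomogenisationLagrangianStepSidebandXTailIntegral
import HarnessLib

/-!
# K1L_D `LagrangianRenormalisationStepDesign` (stmt-AnomalousDissipation-27980), `stub_D1_V0R` (ruling D27-1), brick T8b-2: THE TIME INTEGRAL OF THE OUTSIDE-TAIL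
# ENERGY IS `O(‖F‖²/(lo·R²))` — `∫₀ᵀ tailEnergy ≤ 4k₀(Σⱼ‖αⱼ‖²)·‖F‖²/(8π²·lo·R²)` (helper; `--kind proof --supports stmt-AnomalousDissipation-27980 --as helper`)

Summits-side helper file of route `SolenoidalFractalHomogenisation` (prover seat `ad-k1l-cellLawV-w1` g7; 0 sorry, no defs, no named facts).  The source
`tailEnergy` of the residual energy inequality (`…SidebandXEnergyDefs`) only reads class modes `ℓ + n·w` with `w` in the OUTER SHELL
`box (R + M) \\ box R` (`M ≥ max|mⱼ|_∞`), each at most `2k₀` times; there `|ℓ + n·w| ≥ n R` (`2|ℓ| ≤ n`), so the dissipation integral of the energy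
package (`CellChain.integral_sum_norm_sq_modeRep_le`, V0 memo §3 «TAIL NOTE») makes `∫₀ᵀ tailEnergy` of relative size `1/(lo·R²)` — at `R = R0 ν = ⌈ν⁻³⌉` and
`lo ∼ ν` this is `O(ν⁵)`.
* `sq_sum_two_le` — `(Σⱼ aⱼ(uⱼ+vⱼ))² ≤ 2(Σⱼ aⱼ²)·Σⱼ(uⱼ² + vⱼ²)`; `sum_box_shift_le_sum_shell` — reindexing `z ↦ z ∓ mⱼ` into the shell;
* **`tailEnergy_le_shell_sum`** — `tailEnergy t ≤ 4k₀(Σⱼ‖αⱼ‖²)·Σ_{w ∈ shell} ‖x(k_w, t)‖²`;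
* **`integral_tailEnergy_le`** — the time-integral bound above.
NOT a proof of any registered stub, of K1L_D, or of anomalous dissipation; rung F-D1.A0 infrastructure.
-/

set_option linter.dupNamespace false

noncomputable section

namespace Summit.AnomalousDissipation.AnomalousDissipation.Theorems.SolenoidalFractalHomogenisation.LagrangianStep.Sideband

open Set MeasureTheory Complex UnitAddTorus Finset
open scoped InnerProductSpace
open Literature.Analysis Literature.Analysis.FunctionSpaces Literature.Analysis.FunctionSpaces.Torus
open Literature.Analysis.FluidPDE Literature.Analysis.FluidPDE.Torus Literature.Analysis.FluidPDE.LatticeShear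
open Summit.AnomalousDissipation.AnomalousDissipation.Theorems.SolenoidalFractalHomogenisation.LagrangianStep.CellChain
  (modeRep continuousOn_modeRep integral_sum_norm_sq_modeRep_le)

variable {k₀ : ℕ}

/-! ## §1 Two elementary inequalities -/

/-- `(Σⱼ aⱼ(uⱼ + vⱼ))² ≤ 2(Σⱼ aⱼ²)·Σⱼ(uⱼ² + vⱼ²)` (Cauchy–Schwarz and `(u+v)² ≤ 2u² + 2v²`). [folklore] -/
theorem sq_sum_two_le (a u v : Fin k₀ → ℝ) :
    (∑ j, a j * (u j + v j)) ^ 2 ≤ 2 * (∑ j, a j ^ 2) * ∑ j, (u j ^ 2 + v j ^ 2) := by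
  have hcs : (∑ j, a j * (u j + v j)) ^ 2 ≤ (∑ j, a j ^ 2) * ∑ j, (u j + v j) ^ 2 := Finset.sum_mul_sq_le_sq_mul_sq _ _ _
  have h2 : ∑ j, (u j + v j) ^ 2 ≤ 2 * ∑ j, (u j ^ 2 + v j ^ 2) := by
    rw [Finset.mul_sum]
    exact Finset.sum_le_sum fun j _ => by nlinarith [sq_nonneg (u j - v j)]
  have ha : 0 ≤ ∑ j, a j ^ 2 := Finset.sum_nonneg fun j _ => sq_nonneg _
  nlinarith [mul_le_mul_of_nonneg_left h2 ha]

/-- **Reindexing into the outer shell**: for `g ≥ 0`, `|mᵢ| ≤ M` and the shell `box (R+M) \\ box R`,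
`Σ_{z ∈ box R} [z + m ∉ box R ∧ z + m ≠ 0]·g(z + m) ≤ Σ_{w ∈ box (R+M) \\ box R} g w`. [folklore] -/
theorem sum_box_shift_le_sum_shell {R M : ℕ} {m : Fin 3 → ℤ} (hm : ∀ i, |m i| ≤ (M : ℤ)) {g : (Fin 3 → ℤ) → ℝ} (hg : ∀ w, 0 ≤ g w) :
    ∑ z ∈ box R, (if (z + m ∉ box R ∧ z + m ≠ 0) then g (z + m) else 0) ≤ ∑ w ∈ box (R + M) \ box R, g w := by
  classical
  rw [← Finset.sum_filter]
  rw [← Finset.sum_image (f := g) (s := (box R).filter fun z => z + m ∉ box R ∧ z + m ≠ 0) (g := fun z => z + m)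
    (fun z _ z' _ h => add_right_cancel h)]
  refine Finset.sum_le_sum_of_subset_of_nonneg ?_ fun w _ _ => hg w
  intro w hw
  rw [Finset.mem_image] at hw
  obtain ⟨z, hz, rfl⟩ := hw
  rw [Finset.mem_filter] at hz
  obtain ⟨hzb, hout, hne⟩ := hz
  rw [Finset.mem_sdiff]
  refine ⟨mem_box.2 ⟨fun i => ?_, hne⟩, hout⟩
  have h1 := (mem_box.1 hzb).1 i
  have h2 := hm i
  have h3 := abs_le.1 h2
  simp only [Pi.add_apply]
  constructor <;> push_cast <;> linarith [h1.1, h1.2, h3.1, h3.2]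

/-! ## §2 The tail energy against the shell modes -/

/-- **`tailEnergy t ≤ 4k₀(Σⱼ‖αⱼ‖²)·Σ_{w ∈ box(R+M) \\ box R} ‖x(k_w, t)‖²`** (`M ≥ max|mⱼ|_∞`). [cite: MajdaKramer1999, §2.2.1.3 (cell problem (49))] -/
theorem tailEnergy_le_shell_sum (W₁ : LatticeWord k₀) (n : ℕ) (ℓ : Fin 3 → ℤ) (𝔸 : Torus.Visc4 (Fin 3)) {R M : ℕ}
    (hM : ∀ j i, |(W₁.phase j).m i| ≤ (M : ℤ)) (F : UnitAddTorus (Fin 3) → EuclideanSpace ℝ (Fin 3))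
    (w : ℝ → UnitAddTorus (Fin 3) → EuclideanSpace ℝ (Fin 3)) (t : ℝ) :
    tailEnergy W₁ n ℓ 𝔸 R F w t ≤ 4 * k₀ * (∑ j, ‖slotAmp W₁ j‖ ^ 2) *
      ∑ v ∈ box (R + M) \ box R, ‖modeRep W₁ n ((1 / (n : ℝ) ^ 2) • 𝔸) F w (classFreq n ℓ v) t‖ ^ 2 := by
  classical
  set x : (Fin 3 → ℤ) → ℝ := fun v => ‖modeRep W₁ n ((1 / (n : ℝ) ^ 2) • 𝔸) F w (classFreq n ℓ v) t‖ ^ 2 with hx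
  have hx0 : ∀ v, 0 ≤ x v := fun v => sq_nonneg _
  set A := ∑ j, ‖slotAmp W₁ j‖ ^ 2 with hA
  have hA0 : 0 ≤ A := Finset.sum_nonneg fun j _ => sq_nonneg _
  -- per lattice point: Cauchy–Schwarz
  have hz : ∀ z : box R, (∑ j, ‖slotAmp W₁ j‖ *
      (‖(if (z.1 - (W₁.phase j).m ∉ box R ∧ z.1 - (W₁.phase j).m ≠ 0) then
          modeRep W₁ n ((1 / (n : ℝ) ^ 2) • 𝔸) F w (classFreq n ℓ (z.1 - (W₁.phase j).m)) t else 0)‖ +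
       ‖(if (z.1 + (W₁.phase j).m ∉ box R ∧ z.1 + (W₁.phase j).m ≠ 0) then
          modeRep W₁ n ((1 / (n : ℝ) ^ 2) • 𝔸) F w (classFreq n ℓ (z.1 + (W₁.phase j).m)) t else 0)‖)) ^ 2 ≤
      2 * A * ∑ j, ((if (z.1 - (W₁.phase j).m ∉ box R ∧ z.1 - (W₁.phase j).m ≠ 0) then x (z.1 - (W₁.phase j).m) else 0) +
        (if (z.1 + (W₁.phase j).m ∉ box R ∧ z.1 + (W₁.phase j).m ≠ 0) then x (z.1 + (W₁.phase j).m) else 0)) := by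
    intro z
    refine (sq_sum_two_le _ _ _).trans (le_of_eq ?_)
    congr 1
    refine Finset.sum_congr rfl fun j _ => ?_
    congr 1
    · split_ifs <;> simp [hx]
    · split_ifs <;> simp [hx]
  -- sum over the box, swap, reindex into the shell
  have hminus : ∀ j, ∑ z ∈ box R, (if (z - (W₁.phase j).m ∉ box R ∧ z - (W₁.phase j).m ≠ 0) then x (z - (W₁.phase j).m) else 0) ≤
      ∑ v ∈ box (R + M) \ box R, x v := by
    intro j
    have hm : ∀ i, |(-(W₁.phase j).m) i| ≤ (M : ℤ) := fun i => by rw [Pi.neg_apply, abs_neg]; exact hM j i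
    have h := sum_box_shift_le_sum_shell (R := R) hm hx0
    simpa [sub_eq_add_neg] using h
  have hplus : ∀ j, ∑ z ∈ box R, (if (z + (W₁.phase j).m ∉ box R ∧ z + (W₁.phase j).m ≠ 0) then x (z + (W₁.phase j).m) else 0) ≤
      ∑ v ∈ box (R + M) \ box R, x v := fun j => sum_box_shift_le_sum_shell (R := R) (hM j) hx0
  rw [tailEnergy_def]
  calc _ ≤ ∑ z : box R, 2 * A * ∑ j, ((if (z.1 - (W₁.phase j).m ∉ box R ∧ z.1 - (W₁.phase j).m ≠ 0) then x (z.1 - (W₁.phase j).m) else 0) +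
        (if (z.1 + (W₁.phase j).m ∉ box R ∧ z.1 + (W₁.phase j).m ≠ 0) then x (z.1 + (W₁.phase j).m) else 0)) :=
        Finset.sum_le_sum fun z _ => hz z
    _ = 2 * A * ∑ j, ((∑ z ∈ box R, (if (z - (W₁.phase j).m ∉ box R ∧ z - (W₁.phase j).m ≠ 0) then x (z - (W₁.phase j).m) else 0)) +
        ∑ z ∈ box R, (if (z + (W₁.phase j).m ∉ box R ∧ z + (W₁.phase j).m ≠ 0) then x (z + (W₁.phase j).m) else 0)) := by
        rw [← Finset.mul_sum, Finset.sum_coe_sort (box R) (fun z => ∑ j, ((if (z - (W₁.phase j).m ∉ box R ∧ z - (W₁.phase j).m ≠ 0) then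
          x (z - (W₁.phase j).m) else 0) + (if (z + (W₁.phase j).m ∉ box R ∧ z + (W₁.phase j).m ≠ 0) then x (z + (W₁.phase j).m) else 0))),
          Finset.sum_comm]
        congr 1
        exact Finset.sum_congr rfl fun j _ => Finset.sum_add_distrib
    _ ≤ 2 * A * ∑ _j : Fin k₀, (2 * ∑ v ∈ box (R + M) \ box R, x v) := by
        refine mul_le_mul_of_nonneg_left (Finset.sum_le_sum fun j _ => ?_) (by positivity)
        linarith [hminus j, hplus j]
    _ = 4 * k₀ * A * ∑ v ∈ box (R + M) \ box R, x v := by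
        rw [Finset.sum_const, Finset.card_univ, Fintype.card_fin, nsmul_eq_mul]; ring

/-! ## §3 The time integral -/

/-- On the shell, `|ℓ + n·w|² ≥ n²R²` (`2|ℓ| ≤ n`). [cite: MajdaKramer1999, §2.2.1.3] -/
theorem freqNormSq_classFreq_ge_of_shell {n : ℕ} {ℓ : Fin 3 → ℤ} (hℓ : 2 * Real.sqrt (freqNormSq ℓ) ≤ n) {R M : ℕ} {v : Fin 3 → ℤ}
    (hv : v ∈ box (R + M) \ box R) : ((n : ℝ) * R) ^ 2 ≤ freqNormSq (classFreq n ℓ v) := by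
  rw [Finset.mem_sdiff] at hv
  obtain ⟨hvb, hvR⟩ := hv
  have hne : v ≠ 0 := (mem_box.1 hvb).2
  -- some coordinate exceeds `R`
  have hbig : ∃ i, (R : ℤ) + 1 ≤ |v i| := by
    by_contra hcon
    refine hvR (mem_box.2 ⟨fun i => ?_, hne⟩)
    have hi : |v i| ≤ (R : ℤ) := by
      by_contra h'
      exact hcon ⟨i, by omega⟩
    have h2 := abs_le.1 hi
    constructor <;> linarith [h2.1, h2.2]
  obtain ⟨i, hi⟩ := hbig
  have hR1 : ((R : ℝ) + 1) ^ 2 ≤ freqNormSq v := by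
    have h1 : ((R : ℝ) + 1) ^ 2 ≤ ((v i : ℤ) : ℝ) ^ 2 := by
      have : ((R : ℝ) + 1) ≤ |((v i : ℤ) : ℝ)| := by exact_mod_cast hi
      nlinarith [abs_nonneg (((v i : ℤ) : ℝ)), sq_abs (((v i : ℤ) : ℝ))]
    exact h1.trans (Finset.single_le_sum (f := fun j => ((v j : ℤ) : ℝ) ^ 2) (fun j _ => sq_nonneg _) (Finset.mem_univ i))
  have hsq : (R : ℝ) + 1 ≤ Real.sqrt (freqNormSq v) := by
    rw [← Real.sqrt_sq (by positivity : (0:ℝ) ≤ R + 1)]; exact Real.sqrt_le_sqrt hR1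
  have h := sqrt_freqNormSq_classFreq_ge n ℓ v
  have hn : (0 : ℝ) ≤ n := Nat.cast_nonneg n
  have hnR : (n : ℝ) * R ≤ Real.sqrt (freqNormSq (classFreq n ℓ v)) := by nlinarith [mul_le_mul_of_nonneg_left hsq hn]
  calc ((n : ℝ) * R) ^ 2 ≤ Real.sqrt (freqNormSq (classFreq n ℓ v)) ^ 2 := pow_le_pow_left₀ (by positivity) hnR 2
    _ = freqNormSq (classFreq n ℓ v) := Real.sq_sqrt (freqNormSq_nonneg _)

/-- **THE TIME INTEGRAL OF THE OUTSIDE-TAIL ENERGY**: for a weak solution of the flat tensor cell problem with `𝔹 = (1/n²)•𝔸`, `NearIso 𝔸 lo hi`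
(`lo > 0`), a weakly divergence-free `L²` datum `F`, `2|ℓ| ≤ n`, `R ≥ 1`, `M ≥ max|mⱼ|_∞`:
`∫_{(0,T)} tailEnergy ≤ 4k₀(Σⱼ‖αⱼ‖²)·‖F‖²_{L²}/(8π²·lo·R²)`. [cite: Temam1984, Ch. III §1 Lemma 1.2 (energy inequality)] -/
theorem integral_tailEnergy_le (W₁ : LatticeWord k₀) {n : ℕ} (hn : n ≠ 0) {T : ℝ} (hT : 0 < T) {𝔸 : Torus.Visc4 (Fin 3)} {lo hi : ℝ}
    (h𝔸 : Torus.NearIso 𝔸 lo hi) (hlo : 0 < lo) {F : UnitAddTorus (Fin 3) → EuclideanSpace ℝ (Fin 3)}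
    {w : ℝ → UnitAddTorus (Fin 3) → EuclideanSpace ℝ (Fin 3)} (hF2 : MemLp F 2 volume) (hFdiv : FunctionSpaces.Torus.IsWeaklyDivFree F)
    (hF : Integrable F volume) (h : Torus.IsWeakTensorPassiveVectorOn 0 T ((1 / (n : ℝ) ^ 2) • 𝔸) (W₁.cell n) F w)
    {ℓ : Fin 3 → ℤ} (hℓ : 2 * Real.sqrt (freqNormSq ℓ) ≤ n) {R M : ℕ} (hR : 1 ≤ R) (hM : ∀ j i, |(W₁.phase j).m i| ≤ (M : ℤ)) :
    ∫ t in Ioo 0 T, tailEnergy W₁ n ℓ 𝔸 R F w t ≤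
      4 * k₀ * (∑ j, ‖slotAmp W₁ j‖ ^ 2) * ((∫ x, ‖F x‖ ^ 2) / (8 * Real.pi ^ 2 * lo * (R : ℝ) ^ 2)) := by
  classical
  have hn0 : (0 : ℝ) < n := by exact_mod_cast Nat.pos_of_ne_zero hn
  have h𝔹 : Torus.NearIso ((1 / (n : ℝ) ^ 2) • 𝔸) (1 / (n : ℝ) ^ 2 * lo) (1 / (n : ℝ) ^ 2 * hi) := h𝔸.smul (by positivity)
  have hlo' : 0 < 1 / (n : ℝ) ^ 2 * lo := by positivity
  -- the shell modes
  set S : Finset (Fin 3 → ℤ) := (box (R + M) \ box R).image (classFreq n ℓ) with hS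
  have hR1 : (1 : ℝ) ≤ R := by exact_mod_cast hR
  have hκ : 0 < ((n : ℝ) * R) ^ 2 := by positivity
  have hSκ : ∀ k ∈ S, ((n : ℝ) * R) ^ 2 ≤ freqNormSq k := by
    intro k hk
    rw [hS, Finset.mem_image] at hk
    obtain ⟨v, hv, rfl⟩ := hk
    exact freqNormSq_classFreq_ge_of_shell hℓ hv
  have hmain := integral_sum_norm_sq_modeRep_le W₁ n hT h𝔹 hlo' hF2 hFdiv hF h S hκ hSκ
  -- pointwise comparison
  have hA0 : 0 ≤ 4 * (k₀ : ℝ) * ∑ j, ‖slotAmp W₁ j‖ ^ 2 := by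
    have := Finset.sum_nonneg fun j (_ : j ∈ Finset.univ) => sq_nonneg ‖slotAmp W₁ j‖; positivity
  have hpt : ∀ t, tailEnergy W₁ n ℓ 𝔸 R F w t ≤ 4 * k₀ * (∑ j, ‖slotAmp W₁ j‖ ^ 2) *
      ∑ k ∈ S, ‖modeRep W₁ n ((1 / (n : ℝ) ^ 2) • 𝔸) F w k t‖ ^ 2 := by
    intro t
    refine (tailEnergy_le_shell_sum W₁ n ℓ 𝔸 hM F w t).trans (le_of_eq ?_)
    rw [hS, Finset.sum_image fun v _ v' _ hvv' => classFreq_injective hn ℓ hvv']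
  -- integrate
  have hcontS : ContinuousOn (fun t => ∑ k ∈ S, ‖modeRep W₁ n ((1 / (n : ℝ) ^ 2) • 𝔸) F w k t‖ ^ 2) (Icc 0 T) :=
    continuousOn_finsetSum S fun k _ => ((continuousOn_modeRep W₁ n hT.le h k).norm).pow 2
  have hintS : IntegrableOn (fun t => 4 * k₀ * (∑ j, ‖slotAmp W₁ j‖ ^ 2) * ∑ k ∈ S, ‖modeRep W₁ n ((1 / (n : ℝ) ^ 2) • 𝔸) F w k t‖ ^ 2)
      (Ioo 0 T) volume := ((continuousOn_const.mul hcontS).integrableOn_Icc).mono_set Ioo_subset_Icc_self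
  have hcontT : ContinuousOn (tailEnergy W₁ n ℓ 𝔸 R F w) (Icc 0 T) := by
    have hite : ∀ (P : Prop) [Decidable P] (k : Fin 3 → ℤ),
        ContinuousOn (fun t => (if P then modeRep W₁ n ((1 / (n : ℝ) ^ 2) • 𝔸) F w k t else 0)) (Icc 0 T) := by
      intro P _ k
      by_cases hP : P
      · simp only [hP, if_true]; exact continuousOn_modeRep W₁ n hT.le h k
      · simp only [hP, if_false]; exact continuousOn_const
    have hfun : tailEnergy W₁ n ℓ 𝔸 R F w = fun t => ∑ z : box R, (∑ j, ‖slotAmp W₁ j‖ *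
        (‖(if (z.1 - (W₁.phase j).m ∉ box R ∧ z.1 - (W₁.phase j).m ≠ 0) then
            modeRep W₁ n ((1 / (n : ℝ) ^ 2) • 𝔸) F w (classFreq n ℓ (z.1 - (W₁.phase j).m)) t else 0)‖ +
         ‖(if (z.1 + (W₁.phase j).m ∉ box R ∧ z.1 + (W₁.phase j).m ≠ 0) then
            modeRep W₁ n ((1 / (n : ℝ) ^ 2) • 𝔸) F w (classFreq n ℓ (z.1 + (W₁.phase j).m)) t else 0)‖)) ^ 2 :=
      funext fun t => tailEnergy_def W₁ n ℓ 𝔸 R F w t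
    rw [hfun]
    refine continuousOn_finsetSum _ fun z _ => ContinuousOn.pow (continuousOn_finsetSum _ fun j _ => ?_) 2
    exact continuousOn_const.mul (((hite _ _).norm).add ((hite _ _).norm))
  have hintT : IntegrableOn (tailEnergy W₁ n ℓ 𝔸 R F w) (Ioo 0 T) volume := (hcontT.integrableOn_Icc).mono_set Ioo_subset_Icc_self
  calc ∫ t in Ioo 0 T, tailEnergy W₁ n ℓ 𝔸 R F w t
      ≤ ∫ t in Ioo 0 T, 4 * k₀ * (∑ j, ‖slotAmp W₁ j‖ ^ 2) * ∑ k ∈ S, ‖modeRep W₁ n ((1 / (n : ℝ) ^ 2) • 𝔸) F w k t‖ ^ 2 :=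
        setIntegral_mono hintT hintS hpt
    _ = 4 * k₀ * (∑ j, ‖slotAmp W₁ j‖ ^ 2) * ∫ t in Ioo 0 T, ∑ k ∈ S, ‖modeRep W₁ n ((1 / (n : ℝ) ^ 2) • 𝔸) F w k t‖ ^ 2 := by
        rw [integral_const_mul]
    _ ≤ 4 * k₀ * (∑ j, ‖slotAmp W₁ j‖ ^ 2) * ((∫ x, ‖F x‖ ^ 2) / (8 * Real.pi ^ 2 * (1 / (n : ℝ) ^ 2 * lo) * ((n : ℝ) * R) ^ 2)) :=
        mul_le_mul_of_nonneg_left hmain hA0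
    _ = 4 * k₀ * (∑ j, ‖slotAmp W₁ j‖ ^ 2) * ((∫ x, ‖F x‖ ^ 2) / (8 * Real.pi ^ 2 * lo * (R : ℝ) ^ 2)) := by
        congr 1; congr 1; field_simp

end Summit.AnomalousDissipation.AnomalousDissipation.Theorems.SolenoidalFractalHomogenisation.LagrangianStep.Sideband

end
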